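import Literature.AlgebraicGeometry.HodgeTheory.HypersurfaceResidueFormHolomorphic
import Literature.NumberTheory.Transcendental.FormIntegrationPullbackCharts

/-!
# Pull-backs of holomorphic-in-charts forms along holomorphic maps are holomorphic in charts (programme PG-FERMAT, brick F2a)

Prover seat `hodge-nonav-prover-Bx` (g10), cell `hodge-nonav`, for crux K1-A (stmt-HodgeConjecture-19544): the equivariance step F2 of programme
PG-FERMAT (memo `PROGRAMME-PG-FERMAT-Bx-g10.md`) pulls a holomorphic `2`-form of the Hodge model back along the model automorphism
`HodgeModel.anMap A A (diagonalAut F ha)` and compares classes (`HodgeModel.map_anMap_pullback`, `topHolFormClass_injective`); for this the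
pull-back must again be a HOLOMORPHIC form in charts. This file proves that general fact on the tree's carriers:

* **`isHolomorphicInCharts_pullback`** — for complex manifolds `M`, `N` modelled on `E` (analytic atlases), `β` a `k`-form on `N` holomorphic in charts
  (`Literature.Geometry.Kaehler.IsHolomorphicInCharts`) and `f : M → N` holomorphic (`MDifferentiable 𝓘(ℂ, E) 𝓘(ℂ, E)`, with its real-smooth
  reading supplied), the pull-back `β.pullback 𝓘(ℝ, E) f` is holomorphic in charts: in the charts at `x₀` and `f x₀` it is
  `y ↦ g(σ y) ∘ Λᵏ dσ(y)` with `σ` the (analytic, by Osgood: `SCV.analyticAt_of_differentiableOn`) transition map and `g` the analytic germ of `β`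
  (`MForm.inChart_pullback_apply`, `ContDiffAt.continuousAlternatingMapCompContinuousLinearMap`).

Sorry-free; no definition, no named fact; helper; nothing here says HC ∕ HC_AV is proved. (Huybrechts, *Complex Geometry*, Prop. 2.6.11 ff.:
holomorphic forms pull back to holomorphic forms under holomorphic maps.)
-/

noncomputable section

set_option linter.dupNamespace false

open scoped Manifold ContDiff Topology
open Set Filter

namespace Summit.HodgeConjecture.HodgeConjecture.Theorems.CyclicUnitaryPowersHolFormPullback

open Literature.Geometry.Kaehler Literature.NumberTheory.Transcendental

variable {E : Type*} [NormedAddCommGroup E] [NormedSpace ℂ E] [FiniteDimensional ℂ E]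
  {M : Type*} [TopologicalSpace M] [ChartedSpace E M] [IsManifold 𝓘(ℂ, E) ω M] [IsManifold 𝓘(ℝ, E) ∞ M]
  {N : Type*} [TopologicalSpace N] [ChartedSpace E N] [IsManifold 𝓘(ℂ, E) ω N] [IsManifold 𝓘(ℝ, E) ∞ N]
  {k : ℕ}

/-- **The pull-back of a holomorphic-in-charts form along a holomorphic map is holomorphic in charts.** In the charts at `x₀` and `f x₀`
the representative of `f^*β` is `y ↦ g(σ y) ∘ Λᵏ dσ(y)` (`MForm.inChart_pullback_apply`), `σ` the transition map (complex-differentiable on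
an open set, hence analytic by Osgood's lemma) and `g` the analytic germ of `β`; this is analytic
(`ContDiffAt.continuousAlternatingMapCompContinuousLinearMap` at `n = ω`). The real-differentiability `hfR` of `f` (implied by `hf`; supplied to
avoid a scalar-restriction detour) feeds the chart formula. -/
theorem isHolomorphicInCharts_pullback {β : MForm 𝓘(ℝ, E) N ℂ k} (hβ : IsHolomorphicInCharts β) {f : M → N}
    (hf : MDifferentiable 𝓘(ℂ, E) 𝓘(ℂ, E) f) (hfR : MDifferentiable 𝓘(ℝ, E) 𝓘(ℝ, E) f) :
    IsHolomorphicInCharts (β.pullback 𝓘(ℝ, E) f) := by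
  intro x₀
  set x₁ := f x₀ with hx₁
  obtain ⟨g, hg, hβg⟩ := hβ x₁
  set c₀ : E := extChartAt 𝓘(ℝ, E) x₀ x₀ with hc₀
  set c₁ : E := extChartAt 𝓘(ℝ, E) x₁ x₁ with hc₁
  set σ : E → E := extChartAt 𝓘(ℝ, E) x₁ ∘ f ∘ (extChartAt 𝓘(ℝ, E) x₀).symm with hσ
  -- the good open set around `c₀`
  set U : Set E := (extChartAt 𝓘(ℝ, E) x₀).target ∩
    (extChartAt 𝓘(ℝ, E) x₀).symm ⁻¹' (f ⁻¹' (extChartAt 𝓘(ℝ, E) x₁).source) with hU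
  have hUo : IsOpen U :=
    (continuousOn_extChartAt_symm x₀).isOpen_inter_preimage (isOpen_extChartAt_target x₀)
      ((isOpen_extChartAt_source x₁).preimage hf.continuous)
  have hc₀U : c₀ ∈ U := by
    refine ⟨mem_extChartAt_target x₀, ?_⟩
    show f ((extChartAt 𝓘(ℝ, E) x₀).symm c₀) ∈ (extChartAt 𝓘(ℝ, E) x₁).source
    rw [hc₀, extChartAt_to_inv]
    exact mem_extChartAt_source x₁
  -- `σ` is complex-differentiable on `U`, hence analytic at `c₀`
  have hσU : DifferentiableOn ℂ σ U := by
    intro y hy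
    have h1 : MDifferentiableAt 𝓘(ℂ, E) 𝓘(ℂ, E) f ((extChartAt 𝓘(ℂ, E) x₀).symm y) := hf _
    have h2 : MDifferentiableWithinAt 𝓘(ℂ, E) 𝓘(ℂ, E) (extChartAt 𝓘(ℂ, E) x₀).symm (range 𝓘(ℂ, E)) y :=
      mdifferentiableWithinAt_extChartAt_symm hy.1
    have h3 : MDifferentiableAt 𝓘(ℂ, E) 𝓘(ℂ, E) (extChartAt 𝓘(ℂ, E) x₁) (f ((extChartAt 𝓘(ℂ, E) x₀).symm y)) :=
      mdifferentiableAt_extChartAt (by rw [← extChartAt_source 𝓘(ℂ, E)]; exact hy.2)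
    have h4 := (h3.comp _ h1).comp_mdifferentiableWithinAt y h2
    rw [ModelWithCorners.Boundaryless.range_eq_univ, mdifferentiableWithinAt_univ,
      mdifferentiableAt_iff_differentiableAt] at h4
    exact h4.differentiableWithinAt
  have hσan : AnalyticAt ℂ σ c₀ :=
    Literature.Analysis.Complex.SCV.analyticAt_of_differentiableOn hσU hUo hc₀U
  have hσc₀ : σ c₀ = c₁ := by
    simp only [hσ, hc₀, hc₁, Function.comp_apply, extChartAt_to_inv]
    rw [← hx₁]
  -- the analytic germ of the pull-back
  set G : E → E [⋀^Fin k]→L[ℂ] ℂ := fun y ↦ (g (σ y)).compContinuousLinearMap (fderiv ℂ σ y) with hG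
  have hGan : AnalyticAt ℂ G c₀ := by
    have hgσ : AnalyticAt ℂ g (σ c₀) := by rw [hσc₀]; exact hg
    have h1 : ContDiffAt ℂ ω (fun y ↦ g (σ y)) c₀ := (hgσ.comp hσan).contDiffAt
    have h2 : ContDiffAt ℂ ω (fun y ↦ fderiv ℂ σ y) c₀ := hσan.fderiv.contDiffAt
    exact (ContDiffAt.continuousAlternatingMapCompContinuousLinearMap h1 h2).analyticAt
  refine ⟨G, hGan, ?_⟩
  -- the chart formula, near `c₀`
  have hev1 : ∀ᶠ y in 𝓝 c₀, y ∈ U := hUo.mem_nhds hc₀U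
  have hev2 : ∀ᶠ y in 𝓝 c₀, β.inChart x₁ (σ y) = (g (σ y)).restrictScalars ℝ := by
    have ht : Tendsto σ (𝓝 c₀) (𝓝 c₁) := by rw [← hσc₀]; exact hσan.continuousAt.tendsto
    exact ht.eventually hβg
  filter_upwards [hev1, hev2] with y hyU hyg
  have hyd : DifferentiableAt ℂ σ y := hσU.differentiableAt (hUo.mem_nhds hyU)
  have hfd : fderivWithin ℝ σ (range 𝓘(ℝ, E)) y = (fderiv ℂ σ y).restrictScalars ℝ := by
    rw [ModelWithCorners.Boundaryless.range_eq_univ, fderivWithin_univ]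
    exact (hyd.hasFDerivAt.restrictScalars ℝ).fderiv
  ext v
  rw [MForm.inChart_pullback_apply β hyU.1 (hfR _) hyU.2 v]
  change β.inChart x₁ (σ y) (fun i ↦ fderivWithin ℝ σ (range 𝓘(ℝ, E)) y (v i)) = _
  rw [hyg, hfd]
  rfl

end Summit.HodgeConjecture.HodgeConjecture.Theorems.CyclicUnitaryPowersHolFormPullback

end
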